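import Mathlib
import Summits.Ventures.PercRepro2.OStarModel

/-!
# The gluing model of the star of `b` (blind cell PercRepro2, mine-2 g39, 2026-08-28;
`proofs/MINE2-GLUE.md` §6, row M2-83)

The star of `b` with its edges confined to `a₁, a₂, o` — the mirror of `OStarModel.lean`: the rest's
pattern `P` lives on the four marks `a₁, a₂, a₃, o` (the same six bits, index `3` now `o`), the
open-neighbour set `N = (b–a₁, b–a₂, b–o)`, and the glued state `Sb P N` reads `b`'s sides off
`reach` and `o`'s sides off the glued connection to the mark `3`.  `PSYMb`, `Cb` as before; the
certificate files `BStarCert0 … BStarCert3` decide `0 ≤ Cb` on every typing and every sorted triple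
of `Q`-patterns; `Cb` is symmetric in the patterns (`Cb_swap12`, `Cb_swap23`, `Cb_perm`) and vanishes
when a pattern joins the roots (`Cb_eq_zero_of_p12`).  Own code; standard axioms.
-/

namespace Summit.Ventures.PercRepro2

namespace CovForm

namespace OStar

open OneTyped Untouched

/-- The glued state of the `b`-star: `(q′, L_o, H_o, L_b, H_b, L₃, H₃)` with the pattern's mark `3`
being `o`. -/
def Sb (P : Pat) (N : Nb) : St :=
  (connG P N 1 0, connG P N 0 3, connG P N 1 3, reach P N 0, reach P N 1, connG P N 0 2,
    connG P N 1 2)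

/-- The kernel on the glued `b`-states, symmetrised over the three patterns. -/
def PSYMb (N₁ N₂ N₃ : Nb) (P₁ P₂ P₃ : Pat) : ℤ :=
  KB (Sb P₁ N₁) (Sb P₂ N₂) (Sb P₃ N₃) + KB (Sb P₁ N₁) (Sb P₃ N₂) (Sb P₂ N₃) +
    KB (Sb P₂ N₁) (Sb P₁ N₂) (Sb P₃ N₃) + KB (Sb P₂ N₁) (Sb P₃ N₂) (Sb P₁ N₃) +
    KB (Sb P₃ N₁) (Sb P₁ N₂) (Sb P₂ N₃) + KB (Sb P₃ N₁) (Sb P₂ N₂) (Sb P₁ N₃)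

/-- The gadget sum of the `b`-star for the typing `(t₁, t₂, t_o)` on a pattern triple. -/
def Cb (t₁ t₂ tO : ℕ) (P₁ P₂ P₃ : Pat) : ℤ :=
  ((plc t₁).map fun c₁ => ((plc t₂).map fun c₂ => ((plc tO).map fun cO =>
    PSYMb (c₁.1, c₂.1, cO.1) (c₁.2.1, c₂.2.1, cO.2.1) (c₁.2.2, c₂.2.2, cO.2.2) P₁ P₂ P₃).sum).sum).sum

/-- `PSYMb` is symmetric in its first two patterns. -/
lemma PSYMb_swap12 (N₁ N₂ N₃ : Nb) (P₁ P₂ P₃ : Pat) :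
    PSYMb N₁ N₂ N₃ P₂ P₁ P₃ = PSYMb N₁ N₂ N₃ P₁ P₂ P₃ := by
  unfold PSYMb; ring

/-- `PSYMb` is symmetric in its last two patterns. -/
lemma PSYMb_swap23 (N₁ N₂ N₃ : Nb) (P₁ P₂ P₃ : Pat) :
    PSYMb N₁ N₂ N₃ P₁ P₃ P₂ = PSYMb N₁ N₂ N₃ P₁ P₂ P₃ := by
  unfold PSYMb; ring

/-- The `b`-gadget sum is symmetric in its first two patterns. -/
lemma Cb_swap12 (t₁ t₂ tO : ℕ) (P₁ P₂ P₃ : Pat) : Cb t₁ t₂ tO P₂ P₁ P₃ = Cb t₁ t₂ tO P₁ P₂ P₃ := by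
  unfold Cb; simp only [PSYMb_swap12]

/-- The `b`-gadget sum is symmetric in its last two patterns. -/
lemma Cb_swap23 (t₁ t₂ tO : ℕ) (P₁ P₂ P₃ : Pat) : Cb t₁ t₂ tO P₁ P₃ P₂ = Cb t₁ t₂ tO P₁ P₂ P₃ := by
  unfold Cb; simp only [PSYMb_swap23]

/-- Any permutation of the patterns, from the two swaps. -/
lemma Cb_perm (t₁ t₂ tO : ℕ) (P₁ P₂ P₃ : Pat) :
    Cb t₁ t₂ tO P₁ P₂ P₃ = Cb t₁ t₂ tO P₂ P₁ P₃ ∧ Cb t₁ t₂ tO P₁ P₂ P₃ = Cb t₁ t₂ tO P₁ P₃ P₂ ∧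
      Cb t₁ t₂ tO P₁ P₂ P₃ = Cb t₁ t₂ tO P₂ P₃ P₁ ∧ Cb t₁ t₂ tO P₁ P₂ P₃ = Cb t₁ t₂ tO P₃ P₁ P₂ ∧
      Cb t₁ t₂ tO P₁ P₂ P₃ = Cb t₁ t₂ tO P₃ P₂ P₁ := by
  refine ⟨(Cb_swap12 ..).symm, (Cb_swap23 ..).symm, ?_, ?_, ?_⟩
  · rw [Cb_swap23 t₁ t₂ tO P₂ P₁ P₃, Cb_swap12 t₁ t₂ tO P₁ P₂ P₃]
  · rw [← Cb_swap12 t₁ t₂ tO P₃ P₁ P₂, Cb_swap23 t₁ t₂ tO P₁ P₂ P₃]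
  · rw [← Cb_swap12 t₁ t₂ tO P₃ P₂ P₁, Cb_swap23 t₁ t₂ tO P₂ P₁ P₃, Cb_swap12 t₁ t₂ tO P₁ P₂ P₃]

/-- The glued `b`-state of a pattern joining the roots fails `Q`. -/
lemma Sb_q'_of_p12 {P : Pat} (h : P.1 = true) (N : Nb) : (Sb P N).q' = true := by
  simp [Sb, St.q', connG, connP, h]

/-- `PSYMb` vanishes when one of the patterns joins the roots. -/
lemma PSYMb_eq_zero_of_p12 (N₁ N₂ N₃ : Nb) {P₁ P₂ P₃ : Pat}
    (h : P₁.1 = true ∨ P₂.1 = true ∨ P₃.1 = true) : PSYMb N₁ N₂ N₃ P₁ P₂ P₃ = 0 := by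
  unfold PSYMb
  rcases h with h | h | h
  · rw [KB_eq_zero_of_q' _ _ _ (Or.inl (Sb_q'_of_p12 h N₁)),
      KB_eq_zero_of_q' _ _ _ (Or.inl (Sb_q'_of_p12 h N₁)),
      KB_eq_zero_of_q' _ _ _ (Or.inr (Or.inl (Sb_q'_of_p12 h N₂))),
      KB_eq_zero_of_q' _ _ _ (Or.inr (Or.inr (Sb_q'_of_p12 h N₃))),
      KB_eq_zero_of_q' _ _ _ (Or.inr (Or.inl (Sb_q'_of_p12 h N₂))),
      KB_eq_zero_of_q' _ _ _ (Or.inr (Or.inr (Sb_q'_of_p12 h N₃)))]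
    ring
  · rw [KB_eq_zero_of_q' _ _ _ (Or.inr (Or.inl (Sb_q'_of_p12 h N₂))),
      KB_eq_zero_of_q' _ _ _ (Or.inr (Or.inr (Sb_q'_of_p12 h N₃))),
      KB_eq_zero_of_q' _ _ _ (Or.inl (Sb_q'_of_p12 h N₁)),
      KB_eq_zero_of_q' _ _ _ (Or.inl (Sb_q'_of_p12 h N₁)),
      KB_eq_zero_of_q' _ _ _ (Or.inr (Or.inr (Sb_q'_of_p12 h N₃))),
      KB_eq_zero_of_q' _ _ _ (Or.inr (Or.inl (Sb_q'_of_p12 h N₂)))]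
    ring
  · rw [KB_eq_zero_of_q' _ _ _ (Or.inr (Or.inr (Sb_q'_of_p12 h N₃))),
      KB_eq_zero_of_q' _ _ _ (Or.inr (Or.inl (Sb_q'_of_p12 h N₂))),
      KB_eq_zero_of_q' _ _ _ (Or.inr (Or.inr (Sb_q'_of_p12 h N₃))),
      KB_eq_zero_of_q' _ _ _ (Or.inr (Or.inl (Sb_q'_of_p12 h N₂))),
      KB_eq_zero_of_q' _ _ _ (Or.inl (Sb_q'_of_p12 h N₁)),
      KB_eq_zero_of_q' _ _ _ (Or.inl (Sb_q'_of_p12 h N₁))]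
    ring

/-- The `b`-gadget sum vanishes when one of the patterns joins the roots. -/
lemma Cb_eq_zero_of_p12 (t₁ t₂ tO : ℕ) {P₁ P₂ P₃ : Pat}
    (h : P₁.1 = true ∨ P₂.1 = true ∨ P₃.1 = true) : Cb t₁ t₂ tO P₁ P₂ P₃ = 0 := by
  unfold Cb
  simp only [PSYMb_eq_zero_of_p12 _ _ _ h, List.map_const', List.sum_replicate, smul_zero]

end OStar

end CovForm

end Summit.Ventures.PercRepro2
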